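/-
Copyright (c) 2026 the pub-hodgecm-mathlib formalisation cell (harness21).  Prover seat hodgecm-mathlib-K2Liu-p06 (g3): Track B «K2-LIT»,
hLiu418 = stmt-HodgeConjecture-24832, director req649 (S1) ∕ LEAD F0P6-plan (g11) deal of record 2026-09-04T05:23:13Z = organ Φ1 of ROAD Φ
(ruling «M-155l» §2; CENSUS-41 row Φ1): the COEFFICIENTS file (A2); 2026-09-04.
-/
import Summits.HodgeConjecture.HodgeConjecture.Theorems.K2LiuSiegelUnipotentCharacters   -- ★ (A1) `unipDeltaChar_mul`, `unipDeltaChar_rat_mul`, …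
import Summits.HodgeConjecture.HodgeConjecture.Theorems.K2LiuConstantTermDelta           -- ★ O41.4 `enorm_wt_smul` (+ ★ `CoveringWeightsBochner`)
import HarnessLib

/-!
# Crux `HLiu418`, ROAD Φ, organ Φ1 (A2): THE FOURIER COEFFICIENTS `φ_S(h)` ALONG `N_Δ(L⁺)\N_Δ(𝔸)` IN COVERING-WEIGHT CURRENCY —
# vanishing of the twisted volume, independence of the weight, `N_Δ(𝔸)`-equivariance, and the identity cell

Cell `hodgecm-mathlib`, crux item hLiu418 = `stmt-HodgeConjecture-24832`, route `HCCMUnconditional`; squad K2 ∕ K2Liu, LEAD F0P6-plan (g11 → g12), deal req649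
(S1) (memo `F0/P6/F0P6-plan-g11/DEALS-req649-S1S2S3.v1.F0P6-plan-g11.md` §(S1)), prover K2Liu-p06 (g3).  THEOREMS ONLY (no `def`, no instance, no
notation, no named-fact hypothesis, no `sorry`); lane `--supports stmt-HodgeConjecture-24832 --as helper` (count-neutral).

SETTING.  ★ (D) `K2LiuSiegelUnipotentFourierDefs` (`φ_S(h) = fourierCoeffDelta νN β S φ h = (∫ β dνN)⁻¹ • ∫ β(u) • (conj ψ_S(u) φ(u h)) dνN(u)`),
★ (A1) `K2LiuSiegelUnipotentCharacters` (group law of `ψ_S`, triviality on `N_Δ(L⁺)`), ★ `Literature/MeasureTheory/Group/CoveringWeights{,Bochner}`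
(`IsCoveringWeight`, independence of the weight).  Throughout `νN` is a left-invariant measure on `N_Δ(𝔸) = ↥unipDelta` and `β` an
`N_Δ(L⁺)`-covering weight (★ `K2LiuUnipotentCoveringWeight` produces one with compact support and finite mass) — the currency of ★ O41.4
`K2LiuConstantTermDelta.constTerm_three_cells`.

CONTENTS.
* `isCoveringWeight_comp_mul_left` — translates `β(u₀ ·)` are covering weights (`N_Δ(𝔸)` is commutative, ★ D9 `mul_comm_of_mem_unipDelta`).
* **`integral_wt_smul_unipDeltaChar_eq_zero`** — `∫ β(u) • ψ_S(u) dνN(u) = 0` as soon as `ψ_S(u₀) ≠ 1` for some `u₀ ∈ N_Δ(𝔸)`: «a non-trivial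
  character has integral zero over the compact quotient», by the translation `u ↦ u₀ u` (left-invariance) + ★ weight independence; no quotient
  measure is used.  With ★ (A1) INJECTIVITY this holds for every non-zero `T_L`-skew rational `S`.
* `lintegral_eq_of_isCoveringWeight`, **`fourierCoeffDelta_eq_of_isCoveringWeight`** — `∫ β dνN` and `φ_S(h)` do not depend on `β`.
* **`fourierCoeffDelta_unipDelta_mul`** — EQUIVARIANCE `φ_S(u₀ h) = ψ_S(u₀) · φ_S(h)` (`u₀ ∈ N_Δ(𝔸)`), i.e. `h ↦ φ_S(h)` lies in the `ψ_S`-isotypic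
  part; in particular `φ_S(u h) = ψ_S(u) φ_S(h)` is the shape consumed by the Whittaker-type unfolding of organ Φ2.
* **`fourierCoeffDelta_of_forall_mul_eq_zero ∕ _eq_self`** — THE IDENTITY CELL of Φ2: a left-`N_Δ(𝔸)`-INVARIANT `φ` (e.g. a Siegel section,
  ★ D9 `apply_unipDelta_mul`) has `φ_S(h) = 0` whenever `ψ_S ≢ 1` on `N_Δ(𝔸)`, and `φ_S(h) = φ(h)` whenever `ψ_S ≡ 1` (e.g. `S = 0`).
Hypotheses on `φ` are on the slice `u ↦ φ(u h)` only: continuous, bounded (compact quotient!) and left-`N_Δ(L⁺)`-invariant.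
[MoeglinWaldspurger1995, I.2.6, II.1.7], [Shimura1997, §18.1], [KudlaRallis1994, §2], [Tan1999, §3].

HONEST LABEL.  Count-neutral helper; `HC_CM` is proved only modulo the 7 printed citations (2 remaining named inputs: hLiu418 = `stmt-HodgeConjecture-24832`,
h413 = `stmt-HodgeConjecture-24833`) until rung 0 closes.
-/

set_option autoImplicit false
set_option linter.dupNamespace false -- the mandated namespace repeats `HodgeConjecture.HodgeConjecture`

noncomputable section

open scoped Matrix ENNReal NNReal ComplexConjugate
open NumberField IsDedekindDomain MeasureTheory MeasureTheory.Measure Filter Set Function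
open Literature.NumberTheory.Automorphic Literature.NumberTheory.Automorphic.UnitaryGroup Literature.NumberTheory.GaloisRepresentations
open Literature.NumberTheory.GelbartRogawski1991 Literature.NumberTheory.GelbartRogawski1991.GRConstruction
open Literature.NumberTheory.K2Lit.SiegelDoubled Literature.MeasureTheory.Group

namespace Summit.HodgeConjecture.HodgeConjecture.Cruxes.HLiu418.K2LiuSiegelFourierCoeffDelta

open K2LiuSiegelUnipotentFourierDefs K2LiuSiegelUnipotentCharacters K2LiuUnipotentCoveringWeight K2LiuConstantTermDelta

variable (L : Type) [Field L] [NumberField L] [IsCMField L]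
variable {N M n : ℕ} (e : Fin N × Fin M ≃ Fin n)
  (dV : Fin N → L) (hdV : ∀ i, IsCMField.complexConj L (dV i) = dV i)
  (dW : Fin M → L) (hdW : ∀ i, IsCMField.complexConj L (dW i) = dW i)

/-! ## The Fourier coefficients in covering-weight currency -/

section Coefficients

variable [MeasurableSpace (unipDelta L e dV hdV dW hdW)] [BorelSpace (unipDelta L e dV hdV dW hdW)]

omit [MeasurableSpace (unipDelta L e dV hdV dW hdW)] [BorelSpace (unipDelta L e dV hdV dW hdW)] in
/-- the subgroup action of `N_Δ(L⁺)` on `N_Δ(𝔸)` is left multiplication. [folklore] -/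
theorem smul_eq_coe_mul (γ : unipDeltaRat L e dV hdV dW hdW) (u : unipDelta L e dV hdV dW hdW) :
    γ • u = (γ : unipDelta L e dV hdV dW hdW) * u := rfl

/-- a left translate of an `N_Δ(L⁺)`-covering weight is again one (`N_Δ(𝔸)` is commutative). [folklore] -/
theorem isCoveringWeight_comp_mul_left {β : unipDelta L e dV hdV dW hdW → ℝ≥0∞} (hβ : IsCoveringWeight (unipDeltaRat L e dV hdV dW hdW) β)
    (u₀ : unipDelta L e dV hdV dW hdW) : IsCoveringWeight (unipDeltaRat L e dV hdV dW hdW) fun u => β (u₀ * u) := by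
  refine ⟨hβ.1.comp (measurable_const_mul u₀), fun u => ?_⟩
  have h := hβ.2 (u₀ * u)
  rw [coveringSum_apply] at h ⊢
  rw [← h]
  refine tsum_congr fun γ => ?_
  have hc : u₀ * (γ : unipDelta L e dV hdV dW hdW) = (γ : unipDelta L e dV hdV dW hdW) * u₀ :=
    Subtype.ext (mul_comm_of_mem_unipDelta L e dV hdV dW hdW u₀.2 (γ : unipDelta L e dV hdV dW hdW).2)
  show β (u₀ * ((γ : unipDelta L e dV hdV dW hdW) * u)) = β ((γ : unipDelta L e dV hdV dW hdW) * (u₀ * u))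
  rw [← mul_assoc, ← mul_assoc, hc]

/-- **VANISHING OF THE TWISTED VOLUME: `∫ β(u) • ψ_S(u) dνN(u) = 0`** whenever `ψ_S(u₀) ≠ 1` for some `u₀ ∈ N_Δ(𝔸)` (`νN` left-invariant, `β` an
`N_Δ(L⁺)`-covering weight).  Translating by `u₀` changes `β` into another covering weight (harmless, ★ weight independence) and multiplies the
integral by `ψ_S(u₀)`.  This is «a non-trivial character integrates to zero over the compact quotient», in covering-weight currency; it is the
identity-cell input of Φ2. [cite: MoeglinWaldspurger1995, I.2.6] [cite: KudlaRallis1994, §2] -/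
theorem integral_wt_smul_unipDeltaChar_eq_zero (νN : Measure (unipDelta L e dV hdV dW hdW)) [νN.IsMulLeftInvariant]
    {β : unipDelta L e dV hdV dW hdW → ℝ≥0∞} (hβ : IsCoveringWeight (unipDeltaRat L e dV hdV dW hdW) β) (S : Matrix (Fin n) (Fin n) L)
    {u₀ : unipDelta L e dV hdV dW hdW} (hu₀ : unipDeltaChar L e dV hdV dW hdW S (u₀ : HA L e dV hdV dW hdW) ≠ 1) :
    ∫ u, (β u).toReal • (unipDeltaChar L e dV hdV dW hdW S (u : HA L e dV hdV dW hdW) : ℂ) ∂νN = 0 := by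
  haveI : Countable (unipDeltaRat L e dV hdV dW hdW) := countable_unipDeltaRat L e dV hdV dW hdW
  haveI : MeasurableConstSMul (unipDeltaRat L e dV hdV dW hdW) (unipDelta L e dV hdV dW hdW) :=
    ⟨fun γ => measurable_const_mul (γ : unipDelta L e dV hdV dW hdW)⟩
  haveI : SMulInvariantMeasure (unipDeltaRat L e dV hdV dW hdW) (unipDelta L e dV hdV dW hdW) νN :=
    ⟨fun γ s _hs => measure_preimage_mul νN (γ : unipDelta L e dV hdV dW hdW) s⟩
  -- the character as a `ℂ`-valued function on `N_Δ(𝔸)`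
  have hψm : StronglyMeasurable fun u : unipDelta L e dV hdV dW hdW => (unipDeltaChar L e dV hdV dW hdW S (u : HA L e dV hdV dW hdW) : ℂ) :=
    (continuous_unipDeltaChar_coe L e dV hdV dW hdW S).stronglyMeasurable
  have hψinv : ∀ (γ : unipDeltaRat L e dV hdV dW hdW) (u : unipDelta L e dV hdV dW hdW),
      (unipDeltaChar L e dV hdV dW hdW S ((γ • u : unipDelta L e dV hdV dW hdW) : HA L e dV hdV dW hdW) : ℂ) =
        unipDeltaChar L e dV hdV dW hdW S (u : HA L e dV hdV dW hdW) := fun γ u => by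
    rw [smul_eq_coe_mul, unipDeltaChar_rat_mul]
  by_cases hfin : ∫⁻ u, β u ∂νN = ∞
  · -- not integrable: Bochner junk `0`
    refine integral_undef fun hint => ?_
    have h : ∫⁻ u, ‖(β u).toReal • (unipDeltaChar L e dV hdV dW hdW S (u : HA L e dV hdV dW hdW) : ℂ)‖ₑ ∂νN < ∞ := hint.2
    simp_rw [enorm_wt_smul hβ, ← ofReal_norm, Circle.norm_coe, ENNReal.ofReal_one, one_mul] at h
    exact (ne_of_lt h) hfin
  -- translate by `u₀⁻¹`: `I = ψ(u₀)⁻¹ · I`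
  have hβ' := isCoveringWeight_comp_mul_left L e dV hdV dW hdW hβ u₀
  have hint : ∫⁻ u, ‖(unipDeltaChar L e dV hdV dW hdW S (u : HA L e dV hdV dW hdW) : ℂ)‖ₑ * β u ∂νN < ∞ := by
    simp_rw [← ofReal_norm, Circle.norm_coe, ENNReal.ofReal_one, one_mul]
    exact lt_top_iff_ne_top.2 hfin
  have h1 : ∫ u, (β (u₀ * u)).toReal • (unipDeltaChar L e dV hdV dW hdW S (u : HA L e dV hdV dW hdW) : ℂ) ∂νN =
      ∫ u, (β u).toReal • (unipDeltaChar L e dV hdV dW hdW S (u : HA L e dV hdV dW hdW) : ℂ) ∂νN :=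
    (integral_wt_smul_eq_of_coveringSum_eq_one νN hψm hψinv hβ.1 hβ'.1 hβ.2 hβ'.2 hint).symm
  have h2 : ∫ u, (β (u₀ * u)).toReal • (unipDeltaChar L e dV hdV dW hdW S (u : HA L e dV hdV dW hdW) : ℂ) ∂νN =
      ((unipDeltaChar L e dV hdV dW hdW S (u₀ : HA L e dV hdV dW hdW) : ℂ))⁻¹ *
        ∫ u, (β u).toReal • (unipDeltaChar L e dV hdV dW hdW S (u : HA L e dV hdV dW hdW) : ℂ) ∂νN := by
    have h3 : ∀ u : unipDelta L e dV hdV dW hdW, (β (u₀ * u)).toReal • (unipDeltaChar L e dV hdV dW hdW S (u : HA L e dV hdV dW hdW) : ℂ) =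
        ((unipDeltaChar L e dV hdV dW hdW S (u₀ : HA L e dV hdV dW hdW) : ℂ))⁻¹ *
          ((β (u₀ * u)).toReal • (unipDeltaChar L e dV hdV dW hdW S ((u₀ * u : unipDelta L e dV hdV dW hdW) : HA L e dV hdV dW hdW) : ℂ)) := by
      intro u
      rw [Subgroup.coe_mul, unipDeltaChar_mul L e dV hdV dW hdW S u₀.2 u.2, Circle.coe_mul, Complex.real_smul, Complex.real_smul, ← mul_assoc,
        ← mul_assoc, mul_comm _ (↑(β (u₀ * u)).toReal : ℂ), mul_assoc (↑(β (u₀ * u)).toReal : ℂ), inv_mul_cancel₀ (Circle.coe_ne_zero _), mul_one]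
    simp_rw [h3]
    rw [integral_const_mul,
      integral_mul_left_eq_self (fun u : unipDelta L e dV hdV dW hdW => (β u).toReal • (unipDeltaChar L e dV hdV dW hdW S (u : HA L e dV hdV dW hdW) : ℂ)) u₀]
  have hne : ((unipDeltaChar L e dV hdV dW hdW S (u₀ : HA L e dV hdV dW hdW) : ℂ))⁻¹ ≠ 1 := by
    rw [ne_eq, inv_eq_one, ← Circle.coe_one, Circle.coe_inj]
    exact hu₀
  have h4 : (((unipDeltaChar L e dV hdV dW hdW S (u₀ : HA L e dV hdV dW hdW) : ℂ))⁻¹ - 1) *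
      ∫ u, (β u).toReal • (unipDeltaChar L e dV hdV dW hdW S (u : HA L e dV hdV dW hdW) : ℂ) ∂νN = 0 := by
    rw [sub_mul, one_mul, ← h2, h1, sub_self]
  exact (mul_eq_zero.1 h4).resolve_left (sub_ne_zero.2 hne)

/-- the normalising volume `∫ β dνN` does not depend on the covering weight. [folklore] -/
theorem lintegral_eq_of_isCoveringWeight (νN : Measure (unipDelta L e dV hdV dW hdW)) [νN.IsMulLeftInvariant]
    {β β' : unipDelta L e dV hdV dW hdW → ℝ≥0∞} (hβ : IsCoveringWeight (unipDeltaRat L e dV hdV dW hdW) β)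
    (hβ' : IsCoveringWeight (unipDeltaRat L e dV hdV dW hdW) β') : ∫⁻ u, β u ∂νN = ∫⁻ u, β' u ∂νN := by
  haveI : Countable (unipDeltaRat L e dV hdV dW hdW) := countable_unipDeltaRat L e dV hdV dW hdW
  haveI : MeasurableConstSMul (unipDeltaRat L e dV hdV dW hdW) (unipDelta L e dV hdV dW hdW) :=
    ⟨fun γ => measurable_const_mul (γ : unipDelta L e dV hdV dW hdW)⟩
  haveI : SMulInvariantMeasure (unipDeltaRat L e dV hdV dW hdW) (unipDelta L e dV hdV dW hdW) νN :=
    ⟨fun γ s _hs => measure_preimage_mul νN (γ : unipDelta L e dV hdV dW hdW) s⟩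
  have h := lintegral_mul_eq_of_coveringSum_eq νN (F := fun _ => (1 : ℝ≥0∞)) measurable_const (fun _ _ => rfl) hβ.1 hβ'.1 one_ne_zero
    ENNReal.one_ne_top hβ.2 hβ'.2
  simpa only [one_mul] using h

omit [BorelSpace (unipDelta L e dV hdV dW hdW)] in
/-- the `L¹`-size of a bounded integrand against a finite-mass weight. [folklore] -/
theorem lintegral_enorm_mul_wt_lt_top (νN : Measure (unipDelta L e dV hdV dW hdW)) {β : unipDelta L e dV hdV dW hdW → ℝ≥0∞} (hβm : Measurable β)
    (hβtop : ∫⁻ u, β u ∂νN ≠ ∞) {F : unipDelta L e dV hdV dW hdW → ℂ} {C : ℝ} (hC : ∀ u, ‖F u‖ ≤ C) :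
    ∫⁻ u, ‖F u‖ₑ * β u ∂νN < ∞ := by
  calc ∫⁻ u, ‖F u‖ₑ * β u ∂νN ≤ ∫⁻ u, ENNReal.ofReal C * β u ∂νN := by
        refine lintegral_mono fun u => mul_le_mul' ?_ le_rfl
        rw [← ofReal_norm]
        exact ENNReal.ofReal_le_ofReal (hC u)
    _ = ENNReal.ofReal C * ∫⁻ u, β u ∂νN := lintegral_const_mul _ hβm
    _ < ∞ := ENNReal.mul_lt_top ENNReal.ofReal_lt_top (lt_top_iff_ne_top.2 hβtop)

/-- **`φ_S(h)` does not depend on the covering weight** (for `u ↦ φ(u h)` continuous, bounded and left-`N_Δ(L⁺)`-invariant, `∫ β < ∞`).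
[cite: MoeglinWaldspurger1995, I.2.6] -/
theorem fourierCoeffDelta_eq_of_isCoveringWeight (νN : Measure (unipDelta L e dV hdV dW hdW)) [νN.IsMulLeftInvariant]
    {β β' : unipDelta L e dV hdV dW hdW → ℝ≥0∞} (hβ : IsCoveringWeight (unipDeltaRat L e dV hdV dW hdW) β)
    (hβ' : IsCoveringWeight (unipDeltaRat L e dV hdV dW hdW) β') (hβtop : ∫⁻ u, β u ∂νN ≠ ∞) (S : Matrix (Fin n) (Fin n) L)
    {φ : HA L e dV hdV dW hdW → ℂ} {h : HA L e dV hdV dW hdW} (hφc : Continuous fun u : unipDelta L e dV hdV dW hdW => φ ((u : HA L e dV hdV dW hdW) * h))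
    (hφb : ∃ C, ∀ u : unipDelta L e dV hdV dW hdW, ‖φ ((u : HA L e dV hdV dW hdW) * h)‖ ≤ C)
    (hφ : ∀ (γ : unipDeltaRat L e dV hdV dW hdW) (u : unipDelta L e dV hdV dW hdW),
      φ ((((γ : unipDelta L e dV hdV dW hdW) * u : unipDelta L e dV hdV dW hdW) : HA L e dV hdV dW hdW) * h) = φ ((u : HA L e dV hdV dW hdW) * h)) :
    fourierCoeffDelta L e dV hdV dW hdW νN β S φ h = fourierCoeffDelta L e dV hdV dW hdW νN β' S φ h := by
  haveI : Countable (unipDeltaRat L e dV hdV dW hdW) := countable_unipDeltaRat L e dV hdV dW hdW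
  haveI : MeasurableConstSMul (unipDeltaRat L e dV hdV dW hdW) (unipDelta L e dV hdV dW hdW) :=
    ⟨fun γ => measurable_const_mul (γ : unipDelta L e dV hdV dW hdW)⟩
  haveI : SMulInvariantMeasure (unipDeltaRat L e dV hdV dW hdW) (unipDelta L e dV hdV dW hdW) νN :=
    ⟨fun γ s _hs => measure_preimage_mul νN (γ : unipDelta L e dV hdV dW hdW) s⟩
  have hFm : StronglyMeasurable fun u : unipDelta L e dV hdV dW hdW =>
      conj (unipDeltaChar L e dV hdV dW hdW S (u : HA L e dV hdV dW hdW) : ℂ) * φ ((u : HA L e dV hdV dW hdW) * h) :=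
    ((Complex.continuous_conj.comp (continuous_unipDeltaChar_coe L e dV hdV dW hdW S)).mul hφc).stronglyMeasurable
  have hFinv : ∀ (γ : unipDeltaRat L e dV hdV dW hdW) (u : unipDelta L e dV hdV dW hdW),
      conj (unipDeltaChar L e dV hdV dW hdW S ((γ • u : unipDelta L e dV hdV dW hdW) : HA L e dV hdV dW hdW) : ℂ) *
          φ (((γ • u : unipDelta L e dV hdV dW hdW) : HA L e dV hdV dW hdW) * h) =
        conj (unipDeltaChar L e dV hdV dW hdW S (u : HA L e dV hdV dW hdW) : ℂ) * φ ((u : HA L e dV hdV dW hdW) * h) := fun γ u => by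
    rw [smul_eq_coe_mul, unipDeltaChar_rat_mul, hφ]
  obtain ⟨C, hC⟩ := hφb
  have hint := lintegral_enorm_mul_wt_lt_top L e dV hdV dW hdW νN hβ.1 hβtop
    (F := fun u : unipDelta L e dV hdV dW hdW => conj (unipDeltaChar L e dV hdV dW hdW S (u : HA L e dV hdV dW hdW) : ℂ) * φ ((u : HA L e dV hdV dW hdW) * h))
    (C := C) fun u => (norm_conj_unipDeltaChar_mul L e dV hdV dW hdW S _ _).le.trans (hC u)
  rw [fourierCoeffDelta_def, fourierCoeffDelta_def, lintegral_eq_of_isCoveringWeight L e dV hdV dW hdW νN hβ hβ']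
  congr 1
  exact integral_wt_smul_eq_of_coveringSum_eq_one νN hFm hFinv hβ.1 hβ'.1 hβ.2 hβ'.2 hint

/-- **EQUIVARIANCE `φ_S(u₀ h) = ψ_S(u₀) · φ_S(h)`** for `u₀ ∈ N_Δ(𝔸)` (`νN` left-invariant, `β` an `N_Δ(L⁺)`-covering weight with `∫ β < ∞`, `u ↦ φ(u h)`
continuous bounded and left-`N_Δ(L⁺)`-invariant): translate `u ↦ u₀⁻¹ u` (left-invariance; `N_Δ(𝔸)` is commutative so `u u₀ = u₀ u`), then ★ weight
independence for the translated weight `β(u₀⁻¹ ·)`. [cite: MoeglinWaldspurger1995, I.2.6] [cite: Shimura1997, §18.1] -/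
theorem fourierCoeffDelta_unipDelta_mul (νN : Measure (unipDelta L e dV hdV dW hdW)) [νN.IsMulLeftInvariant]
    {β : unipDelta L e dV hdV dW hdW → ℝ≥0∞} (hβ : IsCoveringWeight (unipDeltaRat L e dV hdV dW hdW) β) (hβtop : ∫⁻ u, β u ∂νN ≠ ∞)
    (S : Matrix (Fin n) (Fin n) L) {φ : HA L e dV hdV dW hdW → ℂ} {h : HA L e dV hdV dW hdW}
    (hφc : Continuous fun u : unipDelta L e dV hdV dW hdW => φ ((u : HA L e dV hdV dW hdW) * h))
    (hφb : ∃ C, ∀ u : unipDelta L e dV hdV dW hdW, ‖φ ((u : HA L e dV hdV dW hdW) * h)‖ ≤ C)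
    (hφ : ∀ (γ : unipDeltaRat L e dV hdV dW hdW) (u : unipDelta L e dV hdV dW hdW),
      φ ((((γ : unipDelta L e dV hdV dW hdW) * u : unipDelta L e dV hdV dW hdW) : HA L e dV hdV dW hdW) * h) = φ ((u : HA L e dV hdV dW hdW) * h))
    (u₀ : unipDelta L e dV hdV dW hdW) :
    fourierCoeffDelta L e dV hdV dW hdW νN β S φ ((u₀ : HA L e dV hdV dW hdW) * h) =
      (unipDeltaChar L e dV hdV dW hdW S (u₀ : HA L e dV hdV dW hdW) : ℂ) * fourierCoeffDelta L e dV hdV dW hdW νN β S φ h := by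
  haveI : Countable (unipDeltaRat L e dV hdV dW hdW) := countable_unipDeltaRat L e dV hdV dW hdW
  haveI : MeasurableConstSMul (unipDeltaRat L e dV hdV dW hdW) (unipDelta L e dV hdV dW hdW) :=
    ⟨fun γ => measurable_const_mul (γ : unipDelta L e dV hdV dW hdW)⟩
  haveI : SMulInvariantMeasure (unipDeltaRat L e dV hdV dW hdW) (unipDelta L e dV hdV dW hdW) νN :=
    ⟨fun γ s _hs => measure_preimage_mul νN (γ : unipDelta L e dV hdV dW hdW) s⟩
  -- notation-free abbreviations
  have hχmul : ∀ u v : unipDelta L e dV hdV dW hdW, unipDeltaChar L e dV hdV dW hdW S ((u * v : unipDelta L e dV hdV dW hdW) : HA L e dV hdV dW hdW) =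
      unipDeltaChar L e dV hdV dW hdW S (u : HA L e dV hdV dW hdW) * unipDeltaChar L e dV hdV dW hdW S (v : HA L e dV hdV dW hdW) := fun u v => by
    rw [Subgroup.coe_mul, unipDeltaChar_mul L e dV hdV dW hdW S u.2 v.2]
  have hχinv : ∀ u : unipDelta L e dV hdV dW hdW, unipDeltaChar L e dV hdV dW hdW S ((u⁻¹ : unipDelta L e dV hdV dW hdW) : HA L e dV hdV dW hdW) =
      (unipDeltaChar L e dV hdV dW hdW S (u : HA L e dV hdV dW hdW))⁻¹ := fun u => by
    rw [Subgroup.coe_inv, unipDeltaChar_inv L e dV hdV dW hdW S u.2]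
  -- the integrand at `h`
  set F : unipDelta L e dV hdV dW hdW → ℂ := fun u =>
    conj (unipDeltaChar L e dV hdV dW hdW S (u : HA L e dV hdV dW hdW) : ℂ) * φ ((u : HA L e dV hdV dW hdW) * h) with hFdef
  have hFm : StronglyMeasurable F :=
    ((Complex.continuous_conj.comp (continuous_unipDeltaChar_coe L e dV hdV dW hdW S)).mul hφc).stronglyMeasurable
  have hFinv : ∀ (γ : unipDeltaRat L e dV hdV dW hdW) (u : unipDelta L e dV hdV dW hdW), F (γ • u) = F u := fun γ u => by
    simp only [hFdef, smul_eq_coe_mul, unipDeltaChar_rat_mul, hφ]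
  obtain ⟨C, hC⟩ := hφb
  have hβ' := isCoveringWeight_comp_mul_left L e dV hdV dW hdW hβ u₀⁻¹
  have hvol : ∫⁻ u, β (u₀⁻¹ * u) ∂νN = ∫⁻ u, β u ∂νN := lintegral_mul_left_eq_self _ u₀⁻¹
  have hint' : ∫⁻ u, ‖F u‖ₑ * β (u₀⁻¹ * u) ∂νN < ∞ :=
    lintegral_enorm_mul_wt_lt_top L e dV hdV dW hdW νN hβ'.1 (by rw [hvol]; exact hβtop) (F := F) (C := C) fun u =>
      (norm_conj_unipDeltaChar_mul L e dV hdV dW hdW S _ _).le.trans (hC u)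
  -- the integrand at `u₀ h`, translated by `u₀⁻¹`
  have hpt : ∀ v : unipDelta L e dV hdV dW hdW,
      (β (u₀⁻¹ * v)).toReal • (conj (unipDeltaChar L e dV hdV dW hdW S ((u₀⁻¹ * v : unipDelta L e dV hdV dW hdW) : HA L e dV hdV dW hdW) : ℂ) *
          φ (((u₀⁻¹ * v : unipDelta L e dV hdV dW hdW) : HA L e dV hdV dW hdW) * ((u₀ : HA L e dV hdV dW hdW) * h))) =
        (unipDeltaChar L e dV hdV dW hdW S (u₀ : HA L e dV hdV dW hdW) : ℂ) * ((β (u₀⁻¹ * v)).toReal • F v) := by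
    intro v
    have hprod : ((u₀⁻¹ * v : unipDelta L e dV hdV dW hdW) : HA L e dV hdV dW hdW) * ((u₀ : HA L e dV hdV dW hdW) * h) = (v : HA L e dV hdV dW hdW) * h := by
      have hc : u₀⁻¹ * v * u₀ = u₀ * (u₀⁻¹ * v) := Subtype.ext (mul_comm_of_mem_unipDelta L e dV hdV dW hdW (u₀⁻¹ * v).2 u₀.2)
      rw [← mul_assoc, ← Subgroup.coe_mul, hc, mul_inv_cancel_left]
    have hconj : conj (unipDeltaChar L e dV hdV dW hdW S ((u₀⁻¹ * v : unipDelta L e dV hdV dW hdW) : HA L e dV hdV dW hdW) : ℂ) =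
        (unipDeltaChar L e dV hdV dW hdW S (u₀ : HA L e dV hdV dW hdW) : ℂ) * conj (unipDeltaChar L e dV hdV dW hdW S (v : HA L e dV hdV dW hdW) : ℂ) := by
      rw [hχmul, hχinv, Circle.coe_mul, map_mul, ← Circle.coe_inv_eq_conj, inv_inv]
    rw [hprod, hconj, hFdef]
    simp only [Complex.real_smul]
    ring
  rw [fourierCoeffDelta_def, fourierCoeffDelta_def,
    ← integral_mul_left_eq_self (fun u : unipDelta L e dV hdV dW hdW => (β u).toReal •
      (conj (unipDeltaChar L e dV hdV dW hdW S (u : HA L e dV hdV dW hdW) : ℂ) * φ ((u : HA L e dV hdV dW hdW) * ((u₀ : HA L e dV hdV dW hdW) * h)))) u₀⁻¹]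
  simp_rw [hpt]
  rw [integral_const_mul, integral_wt_smul_eq_of_coveringSum_eq_one νN hFm hFinv hβ'.1 hβ.1 hβ'.2 hβ.2 hint', Complex.real_smul, Complex.real_smul,
    ← mul_assoc, mul_comm (((∫⁻ u, β u ∂νN).toReal⁻¹ : ℝ) : ℂ), mul_assoc]

/-- **THE IDENTITY CELL: coefficients of a left-`N_Δ(𝔸)`-invariant function** (`φ(u h) = φ(h)` for all `u ∈ N_Δ(𝔸)`, e.g. a Siegel section ★ D9
`apply_unipDelta_mul`): `φ_S(h) = 0` if `ψ_S(u₀) ≠ 1` for some `u₀ ∈ N_Δ(𝔸)`. [cite: KudlaRallis1994, §2] [cite: MoeglinWaldspurger1995, II.1.7] -/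
theorem fourierCoeffDelta_of_forall_mul_eq_zero (νN : Measure (unipDelta L e dV hdV dW hdW)) [νN.IsMulLeftInvariant]
    {β : unipDelta L e dV hdV dW hdW → ℝ≥0∞} (hβ : IsCoveringWeight (unipDeltaRat L e dV hdV dW hdW) β) (S : Matrix (Fin n) (Fin n) L)
    {φ : HA L e dV hdV dW hdW → ℂ} {h : HA L e dV hdV dW hdW} (hφ : ∀ u : unipDelta L e dV hdV dW hdW, φ ((u : HA L e dV hdV dW hdW) * h) = φ h)
    {u₀ : unipDelta L e dV hdV dW hdW} (hu₀ : unipDeltaChar L e dV hdV dW hdW S (u₀ : HA L e dV hdV dW hdW) ≠ 1) :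
    fourierCoeffDelta L e dV hdV dW hdW νN β S φ h = 0 := by
  have h0 : ∫ u, (β u).toReal • conj (unipDeltaChar L e dV hdV dW hdW S (u : HA L e dV hdV dW hdW) : ℂ) ∂νN = 0 := by
    have h1 := integral_wt_smul_unipDeltaChar_eq_zero L e dV hdV dW hdW νN hβ (-S) (u₀ := u₀)
      (by rw [unipDeltaChar_neg, ne_eq, inv_eq_one]; exact hu₀)
    simpa only [coe_unipDeltaChar_neg] using h1
  rw [fourierCoeffDelta_def]
  simp_rw [hφ, ← smul_mul_assoc]
  rw [integral_mul_const, h0, zero_mul, smul_zero]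

omit [BorelSpace (unipDelta L e dV hdV dW hdW)] in
/-- **… and `φ_S(h) = φ(h)` for every index with `ψ_S ≡ 1` on `N_Δ(𝔸)`** (e.g. `S = 0`, or hermitian-type `S`), provided `0 < ∫ β dνN < ∞`.
[cite: KudlaRallis1994, §2] [cite: MoeglinWaldspurger1995, II.1.7] -/
theorem fourierCoeffDelta_of_forall_mul_eq_self (νN : Measure (unipDelta L e dV hdV dW hdW)) {β : unipDelta L e dV hdV dW hdW → ℝ≥0∞}
    (hβm : Measurable β) (hβ1 : ∀ u, β u ≤ 1) (hβ0 : ∫⁻ u, β u ∂νN ≠ 0) (hβtop : ∫⁻ u, β u ∂νN ≠ ∞) (S : Matrix (Fin n) (Fin n) L)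
    (hS : ∀ u : unipDelta L e dV hdV dW hdW, unipDeltaChar L e dV hdV dW hdW S (u : HA L e dV hdV dW hdW) = 1)
    {φ : HA L e dV hdV dW hdW → ℂ} {h : HA L e dV hdV dW hdW} (hφ : ∀ u : unipDelta L e dV hdV dW hdW, φ ((u : HA L e dV hdV dW hdW) * h) = φ h) :
    fourierCoeffDelta L e dV hdV dW hdW νN β S φ h = φ h := by
  rw [fourierCoeffDelta_def]
  simp_rw [hφ, hS, Circle.coe_one, map_one, one_mul]
  rw [integral_smul_const, integral_toReal hβm.aemeasurable (ae_of_all _ fun u => lt_of_le_of_lt (hβ1 u) ENNReal.one_lt_top), smul_smul,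
    inv_mul_cancel₀ (ENNReal.toReal_ne_zero.2 ⟨hβ0, hβtop⟩), one_smul]

end Coefficients


end Summit.HodgeConjecture.HodgeConjecture.Cruxes.HLiu418.K2LiuSiegelFourierCoeffDelta

end
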